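import Summits.KontsevichZagierPeriods.Zeta5Search.Barrier.ConeGammaCuspFloorPattern

/-!
# ζ(5) search — BARRIER: THE CANONICAL PATTERN FUNCTION HAS ORIENTED UNIT MARGINALS ON EVERY PATTERN — `hspread` is a theorem

HONEST FRAMING (cell `pub-zeta5`): systematic search; no irrationality claim unless kernel-certified. MODEL objects
under Brown–Zudilin's (28)+(30) accounting ([BZ22] = arXiv:2210.03391; (28) observed, not proved); nothing here is a
statement about `ζ(5)`, any `γ` of record, the cone's supremum (C2 OPEN) or the value of any pattern function at a named
junction (DATA of the cell); S-E stays CONJECTURED; records in print UNMOVED. Prover P2 g33, item «THE CANONICAL PATTERN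
FUNCTION», file (2) of 3 (theorems only): P2 g26's wall orientation (`ConeGammaWallOrientation`, stated for points of `ℝ⁸`)
carried to ARBITRARY floor vectors, hence to the virtual patterns.

* **`floorTerm_sub_le_oriented`**, **`floorN_sub_le_oriented`**, **`oriented_le_floorN_sub`** — for ALL `N₁, N₂ ∈ ℤ²⁸`:
  `−(Σ_{k∈F}(N₁−N₂)_k⁺ + Σ_{k∉F}(N₂−N₁)_k⁺) ≤ floorN N₂ − floorN N₁ ≤ Σ_{k∈F}(N₂−N₁)_k⁺ + Σ_{k∉F}(N₁−N₂)_k⁺` (every torus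
  term has coefficient in `{0,+1}` on an `F`-entry and in `{−1,0}` on an `F^c`-entry — `oriented_core` with the
  `S₇`-invariance `sum_univ_pair_liftPerm`); **`floorN_mono`**, **`floorN_step`** (one entry up by one ⇒ a step in `{0,+1}`
  for `k ∈ F`, in `{−1,0}` for `k ∉ F`);
* **`patternN_insert_bounds`** — ORIENTED UNIT MARGINALS OF THE CANONICAL PATTERN FUNCTION ON EVERY PATTERN: for every
  height `b`, every set `A` and every form `k`: `0 ≤ patternN a b (A ∪ {k}) − patternN a b A ≤ 1` if `k ∈ F`,
  `−1 ≤ … ≤ 0` if `k ∉ F` (a non-member or a form already in `A` has marginal `0`); `patternN_marginal_abs_le_one`;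
* **`patternN_spread_le_one`** — hence any two marginals of the same form differ by at most `1`:
  `|(patternN(S+k) − patternN S) − (patternN(S'+k) − patternN S')| ≤ 1` for ALL `S, S'` — the hypothesis `hspread` of
  P2 g32's `period_defect_abs_le_junctionCount` / `cuspSlope_le_greedy_add_countGauge` HOLDS for the canonical pattern
  functions, realisable prefixes or not (P2 g31's `junction_greedy_weight_bounds` was the realisable case).
DESK (DATA, `HOME/pub-zeta5-p2/g33/alg/canon.py` (D3)): marginals of `patternN` on 950 random (junction, pattern, member) at
the four named directions: values in `{−1,0,+1}`, 0 orientation violations (P2 g32's (W6) re-done on the floor formula).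
NOT here: any marginal at a named junction; the type of any junction; `γ`, C2, S-E, `ζ(5)`.
-/

noncomputable section

open Set MeasureTheory Finset
open scoped Topology

namespace Summit.KontsevichZagierPeriods.Zeta5Search.Barrier.ConeGamma

/-! ### The oriented Lipschitz bound on arbitrary floor vectors -/

/-- **ORIENTED LIPSCHITZ BOUND for one floor term.** For every `σ ∈ S₇` and all `N₁, N₂ ∈ ℤ²⁸`:
`floorTerm N₂ σ − floorTerm N₁ σ ≤ Σ_{k∈F} (N₂ k − N₁ k)⁺ + Σ_{k∉F} (N₁ k − N₂ k)⁺`. -/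
theorem floorTerm_sub_le_oriented (N₁ N₂ : Fin 28 → ℤ) (σ : Equiv.Perm (Fin 7)) :
    floorTerm N₂ σ - floorTerm N₁ σ ≤
      ∑ k ∈ FIdx, max (N₂ k - N₁ k) 0 + ∑ k ∈ FIdxᶜ, max (N₁ k - N₂ k) 0 := by
  have hdiff : floorTerm N₂ σ - floorTerm N₁ σ =
      ∑ i ∈ FIdx, (N₂ i - N₁ i) -
        ∑ i ∈ FIdx, (pairVal N₂ (liftPerm σ (fstIdx i)) (liftPerm σ (sndIdx i)) -
          pairVal N₁ (liftPerm σ (fstIdx i)) (liftPerm σ (sndIdx i))) := by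
    simp only [floorTerm, Finset.sum_sub_distrib]; ring
  have hall := sum_univ_pair_liftPerm σ (fun i j => pairVal N₂ i j - pairVal N₁ i j)
    (fun i j => by rw [pairVal_comm N₂, pairVal_comm N₁])
  have hpos := sum_univ_pair_liftPerm σ (fun i j => max (pairVal N₂ i j - pairVal N₁ i j) 0)
    (fun i j => by rw [pairVal_comm N₂, pairVal_comm N₁])
  simp only [pairVal_fstIdx_sndIdx] at hall hpos
  have key := oriented_core (d := fun k => N₂ k - N₁ k)
    (e := fun k => pairVal N₂ (liftPerm σ (fstIdx k)) (liftPerm σ (sndIdx k)) -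
      pairVal N₁ (liftPerm σ (fstIdx k)) (liftPerm σ (sndIdx k))) hall hpos
  simp only [neg_sub] at key
  rw [hdiff]
  exact key

/-- **ORIENTED LIPSCHITZ BOUND for the floor value, upper half.** For all `N₁, N₂ ∈ ℤ²⁸`:
`floorN N₂ − floorN N₁ ≤ Σ_{k∈F} (N₂ k − N₁ k)⁺ + Σ_{k∉F} (N₁ k − N₂ k)⁺` — only favourable unit moves (an `F`-entry up, an
`F^c`-entry down) can raise the value, each by at most one. -/
theorem floorN_sub_le_oriented (N₁ N₂ : Fin 28 → ℤ) :
    floorN N₂ - floorN N₁ ≤ ∑ k ∈ FIdx, max (N₂ k - N₁ k) 0 + ∑ k ∈ FIdxᶜ, max (N₁ k - N₂ k) 0 := by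
  obtain ⟨σ, hσ⟩ := exists_floorTerm_eq_floorN N₂
  have h2 := floorTerm_le_floorN N₁ σ
  have h3 := floorTerm_sub_le_oriented N₁ N₂ σ
  linarith

/-- **ORIENTED LIPSCHITZ BOUND for the floor value, lower half** (the upper half with `N₁ ↔ N₂`). -/
theorem oriented_le_floorN_sub (N₁ N₂ : Fin 28 → ℤ) :
    -(∑ k ∈ FIdx, max (N₁ k - N₂ k) 0 + ∑ k ∈ FIdxᶜ, max (N₂ k - N₁ k) 0) ≤ floorN N₂ - floorN N₁ := by
  have h := floorN_sub_le_oriented N₂ N₁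
  linarith

/-- **The floor value is monotone in every entry, with orientation**: `F`-entries weakly up and `F^c`-entries weakly down
⇒ `floorN N₁ ≤ floorN N₂`. -/
theorem floorN_mono {N₁ N₂ : Fin 28 → ℤ} (hF : ∀ k ∈ FIdx, N₁ k ≤ N₂ k) (hFc : ∀ k ∉ FIdx, N₂ k ≤ N₁ k) :
    floorN N₁ ≤ floorN N₂ := by
  have h := oriented_le_floorN_sub N₁ N₂
  have h1 : ∑ k ∈ FIdx, max (N₁ k - N₂ k) 0 = 0 :=
    Finset.sum_eq_zero fun k hk => by rw [max_eq_right]; linarith [hF k hk]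
  have h2 : ∑ k ∈ FIdxᶜ, max (N₂ k - N₁ k) 0 = 0 :=
    Finset.sum_eq_zero fun k hk => by rw [max_eq_right]; linarith [hFc k (Finset.mem_compl.mp hk)]
  rw [h1, h2] at h
  linarith

/-- **ONE ENTRY UP BY ONE.** If `N₂ k₀ = N₁ k₀ + 1` and the other 27 entries agree, then `floorN` moves by a step in
`{0, +1}` if `k₀ ∈ F` and in `{−1, 0}` if `k₀ ∉ F`. -/
theorem floorN_step {N₁ N₂ : Fin 28 → ℤ} {k₀ : Fin 28} (hk₀ : N₂ k₀ = N₁ k₀ + 1)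
    (hother : ∀ k, k ≠ k₀ → N₂ k = N₁ k) :
    (k₀ ∈ FIdx → floorN N₁ ≤ floorN N₂ ∧ floorN N₂ ≤ floorN N₁ + 1) ∧
    (k₀ ∉ FIdx → floorN N₂ ≤ floorN N₁ ∧ floorN N₁ ≤ floorN N₂ + 1) := by
  have hU := floorN_sub_le_oriented N₁ N₂
  have hL := oriented_le_floorN_sub N₁ N₂
  have e1 : ∀ k, max (N₂ k - N₁ k) 0 = if k = k₀ then 1 else 0 := by
    intro k
    by_cases h : k = k₀
    · rw [if_pos h, h, hk₀]; simp
    · rw [if_neg h, hother k h]; simp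
  have e2 : ∀ k, max (N₁ k - N₂ k) 0 = 0 := by
    intro k
    by_cases h : k = k₀
    · rw [h, hk₀]; simp
    · rw [hother k h]; simp
  simp only [e1, e2, Finset.sum_const_zero, add_zero, zero_add, Finset.sum_ite_eq'] at hU hL
  constructor
  · intro hk
    have hk' : k₀ ∉ FIdxᶜ := fun h => (Finset.mem_compl.mp h) hk
    rw [if_pos hk] at hU
    rw [if_neg hk'] at hL
    constructor <;> linarith
  · intro hk
    rw [if_neg hk] at hU
    rw [if_pos (Finset.mem_compl.mpr hk)] at hL
    constructor <;> linarith

/-! ### Oriented unit marginals of the canonical pattern function, on every pattern -/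

/-- **ORIENTED UNIT MARGINALS ON EVERY PATTERN.** For every height `b`, every set of forms `A` and every form `k`:
`patternN a b A ≤ patternN a b (insert k A) ≤ patternN a b A + 1` if `k ∈ F`, and
`patternN a b (insert k A) ≤ patternN a b A ≤ patternN a b (insert k A) + 1` if `k ∉ F` — realisable or not (inserting a
member raises exactly its own floor by one; a non-member, or a form already in `A`, changes nothing). -/
theorem patternN_insert_bounds (a : Dir) (b : ℝ) (A : Finset (Fin 28)) (k : Fin 28) :
    (k ∈ FIdx → patternN a b A ≤ patternN a b (insert k A) ∧ patternN a b (insert k A) ≤ patternN a b A + 1) ∧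
    (k ∉ FIdx → patternN a b (insert k A) ≤ patternN a b A ∧ patternN a b A ≤ patternN a b (insert k A) + 1) := by
  classical
  by_cases htriv : k ∈ A ∨ ¬ ∃ z : ℤ, b * h28 a k = z
  · -- nothing moves: the two floor vectors coincide
    have he : patternN a b (insert k A) = patternN a b A := by
      refine patternN_congr fun l hl => ?_
      rw [Finset.mem_insert]
      constructor
      · rintro (rfl | h)
        · rcases htriv with h' | h'
          · exact h'
          · exact absurd hl h'
        · exact h
      · exact fun h => Or.inr h
    rw [he]
    exact ⟨fun _ => ⟨le_rfl, by linarith⟩, fun _ => ⟨le_rfl, by linarith⟩⟩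
  · push Not at htriv
    obtain ⟨hkA, hmem⟩ := htriv
    -- exactly the floor of `k` goes up by one
    unfold patternN
    refine floorN_step (k₀ := k) ?_ ?_
    · rw [if_neg (fun h => h.2 (Finset.mem_insert_self k A)), if_pos ⟨hmem, hkA⟩]; ring
    · intro l hl
      by_cases hm : (∃ z : ℤ, b * h28 a l = z) ∧ l ∉ A
      · have hl' : l ∉ insert k A := fun h => by
          rcases Finset.mem_insert.mp h with h | h
          · exact hl h
          · exact hm.2 h
        rw [if_pos hm, if_pos ⟨hm.1, hl'⟩]
      · rw [if_neg hm, if_neg (fun h => hm ⟨h.1, fun h' => h.2 (Finset.mem_insert_of_mem h')⟩)]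

/-- **Every marginal of the canonical pattern function is `−1`, `0` or `+1` in size**:
`|patternN a b (insert k A) − patternN a b A| ≤ 1`. -/
theorem patternN_marginal_abs_le_one (a : Dir) (b : ℝ) (A : Finset (Fin 28)) (k : Fin 28) :
    |patternN a b (insert k A) - patternN a b A| ≤ 1 := by
  obtain ⟨h1, h2⟩ := patternN_insert_bounds a b A k
  rw [abs_le]
  by_cases hk : k ∈ FIdx
  · obtain ⟨e1, e2⟩ := h1 hk
    constructor <;> linarith
  · obtain ⟨e1, e2⟩ := h2 hk
    constructor <;> linarith

/-- **UNIT MARGINAL SPREAD ON EVERY PAIR OF PATTERNS** — the hypothesis `hspread` of P2 g32's junction-count gauge HOLDS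
for the canonical pattern function: for all sets `S, S'` and every form `k`,
`|(patternN(S+k) − patternN S) − (patternN(S'+k) − patternN S')| ≤ 1` (both marginals lie in the same unit interval,
`[0,1]` or `[−1,0]` according to `k ∈ F`). Real-valued, as the chain consumes it. -/
theorem patternN_spread_le_one (a : Dir) (b : ℝ) (S S' : Finset (Fin 28)) (k : Fin 28) :
    |(((patternN a b (insert k S) : ℤ) : ℝ) - patternN a b S) -
        (((patternN a b (insert k S') : ℤ) : ℝ) - patternN a b S')| ≤ 1 := by
  obtain ⟨h1, h2⟩ := patternN_insert_bounds a b S k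
  obtain ⟨h1', h2'⟩ := patternN_insert_bounds a b S' k
  rw [abs_le]
  by_cases hk : k ∈ FIdx
  · obtain ⟨e1, e2⟩ := h1 hk
    obtain ⟨e1', e2'⟩ := h1' hk
    have c1 := (Int.cast_le (R := ℝ)).mpr e1
    have c2 := (Int.cast_le (R := ℝ)).mpr e2
    have c1' := (Int.cast_le (R := ℝ)).mpr e1'
    have c2' := (Int.cast_le (R := ℝ)).mpr e2'
    push_cast at c1 c2 c1' c2'
    constructor <;> linarith
  · obtain ⟨e1, e2⟩ := h2 hk
    obtain ⟨e1', e2'⟩ := h2' hk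
    have c1 := (Int.cast_le (R := ℝ)).mpr e1
    have c2 := (Int.cast_le (R := ℝ)).mpr e2
    have c1' := (Int.cast_le (R := ℝ)).mpr e1'
    have c2' := (Int.cast_le (R := ℝ)).mpr e2'
    push_cast at c1 c2 c1' c2'
    constructor <;> linarith

end Summit.KontsevichZagierPeriods.Zeta5Search.Barrier.ConeGamma

end
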